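import Mathlib
import Literature.NumberTheory.LFunctions.VinogradovZetaSumEstimate
import Summits.ValiantsHypothesis.ValiantsHypothesis.Theorems.LiouvilleSarnakAlignedTypeICharactersMod2nBilinearSieveKorobovFactors
import Summits.ValiantsHypothesis.ValiantsHypothesis.Theorems.LiouvilleSarnakAlignedTypeICharactersMod2nBilinearSieveKorobovStep
import Summits.ValiantsHypothesis.ValiantsHypothesis.Theorems.LiouvilleSarnakAlignedTypeICharactersMod2nBilinearSievePostnikovUsum
import HarnessLib

/-!
# Route LiouvilleSarnak — support `AlignedTypeI` (stmt-ValiantsHypothesis-21040), line `characters_mod_2n`: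
# Korobov's bound for the Postnikov sums of a primitive character mod `2^{n+τ}`

Brick (B4a) of `HS` (short character sums mod `q = 2^j`).  The tree now has: Postnikov's formula and the
identification of the Postnikov sums `Σ_{x,y≤a} χ(1 + 2^τ ñ xy)` with Korobov's `VKZeta.Usum a (α ñ)` of degree
`n + τ` (`…PostnikovUsum.lean`, leafhand-1), the good-factor bound for `2`-power denominators
(`…KorobovFactors.lean`) and the generic Korobov step `norm_Usum_le_of_good` (`…KorobovStep.lean`).  This file
joins them:

* `Usum_eq_Usum_truncate` — the Weyl sum of degree `R` equals the one of degree `r ≤ R` when the coefficients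
  `α_i`, `i ≥ r`, are integers (for the Postnikov phase: `τ(i+1) ≥ n + τ + v₂(i+1)`);
* `postnikovCoeff_int` / `postnikovCoeff_twoPower` — for odd `ñ` (and the odd multiplier `c`), the coefficient
  `α ñ i = c(−1)^i((n+τ)!/(i+1))2^{τ(i+1)}ñ^{i+1}/2^{n+τ+s}` (`s = v₂((n+τ)!)`) is an INTEGER when
  `τ(i+1) ≥ n+τ+v₂(i+1)` and otherwise `≡ b/2^e (mod 1)` with `b` odd and the EXACT exponent
  `e = n + τ + v₂(i+1) − τ(i+1)`;
* `norm_postnikovSum_le` — ★ for a primitive `χ` mod `2^{n+τ}` (`n ≥ 1`, `τ ≥ 2`), odd `ñ`, and Korobov parameters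
  `Y ≥ 10`, `L ≥ 10⁶Y²`, `4.91Y ≤ r ≤ 5.01Y`, `k = 5r²`, `1 ≤ a ≤ e^{0.4L}`, a truncation condition for `m > r`
  and good indices `m ∈ (M₂, M₃]` (`#∈[1.5Y−1, 1.5Y+1]`) with `2^{e_m} ≤ k a^m`, `(4 + log 2^{e_m})/2^{e_m} ≤ θ*`:
  `‖Σ_{x,y≤a} χ(1 + 2^τ ñ xy)‖ ≤ a² e^{10} exp(−2·10⁻⁶ L/Y²)`.

What remains for `HS` after this file: the parameter choice (`r = ⌊5.01Y⌋`, `τ ≈ j/(r+1)`, `a ≈ N^{0.39}`, good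
`m ∈ (2Y, 3.5Y]`, verifying the displayed side conditions) and Gallagher's assembly (`…ShortCharSumsShift.lean`).

HONEST FRAMING. Helper theorems only (unconditional); the leaf `AlignedTypeI` is NOT closed here; nothing bears on
`VP ≠ VNP` (NOT proved).
-/

set_option linter.dupNamespace false

noncomputable section

namespace Summit.ValiantsHypothesis.ValiantsHypothesis.Theorems.LiouvilleSarnak.AlignedTypeI.CharactersModTwoN

open Finset Real
open Literature.NumberTheory.LFunctions
open Literature.NumberTheory.LFunctions.VMV (E nu E_eq_e_sum J)
open Literature.NumberTheory.LFunctions.VKZeta (Usum mnSum Abnd thetaStar J_le_four)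

/-! ### Truncating the degree of the Weyl sum -/

/-- **Truncation**: if `α_i ∈ ℤ` for `r ≤ i < R`, then `Usum a α` (degree `R`) equals `Usum a (α|_{i<r})`.
[folklore] -/
theorem Usum_eq_Usum_truncate {r R : ℕ} (h : r ≤ R) (a : ℕ) (α : Fin R → ℝ)
    (hint : ∀ i : Fin R, r ≤ i.val → ∃ z : ℤ, α i = z) :
    Usum a α = Usum a (fun i : Fin r => α (Fin.castLE h i)) := by
  classical
  -- integer values of the high coefficients, as a function on `ℕ`
  have hZ : ∃ Z : ℕ → ℤ, ∀ i : Fin R, r ≤ i.val → α i = Z i.val := by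
    refine ⟨fun i => if hi : i < R ∧ r ≤ i then Classical.choose (hint ⟨i, hi.1⟩ hi.2) else 0, fun i hi => ?_⟩
    have hcond : (i.val < R ∧ r ≤ i.val) := ⟨i.isLt, hi⟩
    simp only [dif_pos hcond]
    exact Classical.choose_spec (hint ⟨i.val, i.isLt⟩ hi)
  obtain ⟨Z, hZ⟩ := hZ
  set g : ℕ → ℝ := fun i => if hi : i < R then α ⟨i, hi⟩ else 0 with hg
  unfold Usum
  refine sum_congr rfl fun x _ => sum_congr rfl fun y _ => ?_
  rw [E_eq_e_sum, E_eq_e_sum]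
  set z : ℤ := x * y with hz
  have hfull : ∑ j : Fin R, ((nu R z j : ℤ) : ℝ) * α j = ∑ i ∈ range R, (z : ℝ) ^ (i + 1) * g i := by
    rw [← Fin.sum_univ_eq_sum_range (fun i => (z : ℝ) ^ (i + 1) * g i) R]
    refine sum_congr rfl fun j _ => ?_
    simp only [hg, dif_pos j.isLt, nu]; push_cast; rfl
  have htrunc : ∑ j : Fin r, ((nu r z j : ℤ) : ℝ) * α (Fin.castLE h j) = ∑ i ∈ range r, (z : ℝ) ^ (i + 1) * g i := by
    rw [← Fin.sum_univ_eq_sum_range (fun i => (z : ℝ) ^ (i + 1) * g i) r]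
    refine sum_congr rfl fun j _ => ?_
    have hj : j.val < R := lt_of_lt_of_le j.isLt h
    simp only [hg, dif_pos hj, nu]; push_cast; rfl
  have htail : ∑ i ∈ Ico r R, (z : ℝ) ^ (i + 1) * g i = ((∑ i ∈ Ico r R, z ^ (i + 1) * Z i : ℤ) : ℝ) := by
    push_cast
    refine sum_congr rfl fun i hi => ?_
    rw [mem_Ico] at hi
    simp only [hg, dif_pos hi.2]
    rw [hZ ⟨i, hi.2⟩ hi.1]
  rw [hfull, htrunc, ← Finset.sum_range_add_sum_Ico _ h, htail, VdC.e_add_int]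

/-! ### The exact `2`-power form of the Postnikov coefficients -/

/-- The odd part of `(n+τ)!/m` (`1 ≤ m ≤ n+τ`): `(n+τ)!/m = 2^{s − v₂(m)} u` with `u` odd, `s = v₂((n+τ)!)`,
`v₂(m) ≤ s`. [folklore] -/
theorem factorial_div_eq_two_pow_mul_odd {R m : ℕ} (hm1 : 1 ≤ m) (hmR : m ≤ R) :
    ∃ u : ℕ, Odd u ∧ R.factorial / m = 2 ^ (padicValNat 2 R.factorial - padicValNat 2 m) * u ∧
      padicValNat 2 m ≤ padicValNat 2 R.factorial := by
  haveI := Fact.mk Nat.prime_two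
  have hdvd : m ∣ R.factorial := Nat.dvd_factorial hm1 hmR
  have hq0 : R.factorial / m ≠ 0 := (Nat.div_pos (Nat.le_of_dvd (Nat.factorial_pos R) hdvd) hm1).ne'
  obtain ⟨e, u, hu, hqe⟩ := Nat.exists_eq_two_pow_mul_odd hq0
  have hval : padicValNat 2 (R.factorial / m) = padicValNat 2 R.factorial - padicValNat 2 m :=
    padicValNat.div_of_dvd hdvd
  have hu0 : u ≠ 0 := by rintro rfl; exact (by decide : ¬ Odd (0 : ℕ)) hu
  have hval2 : padicValNat 2 (R.factorial / m) = e := by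
    rw [hqe, padicValNat.mul (pow_ne_zero _ two_ne_zero) hu0, padicValNat.prime_pow,
      padicValNat.eq_zero_of_not_dvd hu.not_two_dvd_nat, add_zero]
  have hvs : padicValNat 2 m ≤ padicValNat 2 R.factorial :=
    (padicValNat_dvd_iff_le (Nat.factorial_pos R).ne').1 (pow_padicValNat_dvd.trans hdvd)
  refine ⟨u, hu, ?_, hvs⟩
  rw [← hval, hval2]; exact hqe

/-- **Integral Postnikov coefficients**: for `m = i+1` with `n + τ + v₂(m) ≤ τ m`, the coefficient `α ñ i` is an
integer (any `c, ñ`). [folklore] -/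
theorem postnikovCoeff_int {n τ : ℕ} (c nt : ℕ) (i : Fin (n + τ))
    (hbig : n + τ + padicValNat 2 (i.val + 1) ≤ τ * (i.val + 1)) :
    ∃ z : ℤ, (c : ℝ) * (-1) ^ (i.val) * (((n + τ).factorial / (i.val + 1) : ℕ) : ℝ) * (2 : ℝ) ^ (τ * (i.val + 1)) *
          (nt : ℝ) ^ (i.val + 1) / (2 : ℝ) ^ (n + τ + padicValNat 2 (n + τ).factorial) = z := by
  set m := i.val + 1 with hm
  set s := padicValNat 2 (n + τ).factorial with hs
  obtain ⟨u, -, hqu, hvs⟩ := factorial_div_eq_two_pow_mul_odd (R := n + τ) (m := m) (by omega) (by omega)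
  -- exponent of `2` in the numerator: `s − v₂(m) + τ m ≥ n + τ + s`
  have hE : n + τ + s ≤ (s - padicValNat 2 m) + τ * m := by omega
  obtain ⟨d, hd⟩ := Nat.exists_eq_add_of_le hE
  refine ⟨(-1) ^ (i.val) * ((c * u * nt ^ m * 2 ^ d : ℕ) : ℤ), ?_⟩
  rw [hqu]
  have h2 : (2 : ℝ) ^ (n + τ + s) ≠ 0 := pow_ne_zero _ two_ne_zero
  rw [div_eq_iff h2]
  push_cast
  have epow : (2 : ℝ) ^ (s - padicValNat 2 m) * (2 : ℝ) ^ (τ * m) = (2 : ℝ) ^ (n + τ + s) * (2 : ℝ) ^ d := by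
    rw [← pow_add, ← pow_add, hd]
  linear_combination (c : ℝ) * (-1) ^ (i.val) * (u : ℝ) * (nt : ℝ) ^ m * epow

/-- **The good Postnikov coefficients**: for odd `c`, odd `ñ` and `m = i+1` with `τ m < n + τ + v₂(m)`,
`α ñ i = b/2^e` with `b` odd and `e = n + τ + v₂(m) − τ m`. [folklore] -/
theorem postnikovCoeff_twoPower {n τ : ℕ} {c nt : ℕ} (hc : Odd c) (hnt : Odd nt) (i : Fin (n + τ))
    (hsmall : τ * (i.val + 1) < n + τ + padicValNat 2 (i.val + 1)) :
    ∃ b : ℤ, Odd b ∧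
      (c : ℝ) * (-1) ^ (i.val) * (((n + τ).factorial / (i.val + 1) : ℕ) : ℝ) * (2 : ℝ) ^ (τ * (i.val + 1)) *
          (nt : ℝ) ^ (i.val + 1) / (2 : ℝ) ^ (n + τ + padicValNat 2 (n + τ).factorial) =
        (b : ℝ) / 2 ^ (n + τ + padicValNat 2 (i.val + 1) - τ * (i.val + 1)) + ((0 : ℤ) : ℝ) := by
  set m := i.val + 1 with hm
  set s := padicValNat 2 (n + τ).factorial with hs
  obtain ⟨u, hu, hqu, hvs⟩ := factorial_div_eq_two_pow_mul_odd (R := n + τ) (m := m) (by omega) (by omega)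
  set e := n + τ + padicValNat 2 m - τ * m with he
  refine ⟨(-1) ^ (i.val) * ((c * u * nt ^ m : ℕ) : ℤ), ?_, ?_⟩
  · rw [Int.odd_mul]
    refine ⟨Odd.pow (by decide), ?_⟩
    exact_mod_cast (hc.mul hu).mul (hnt.pow)
  rw [hqu]
  have h2a : (2 : ℝ) ^ (n + τ + s) ≠ 0 := pow_ne_zero _ two_ne_zero
  have h2b : (2 : ℝ) ^ e ≠ 0 := pow_ne_zero _ two_ne_zero
  rw [Int.cast_zero, add_zero, div_eq_div_iff h2a h2b]
  push_cast
  -- `2^{s − v₂ m} 2^{τ m} 2^e = 2^{n+τ+s}`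
  have epow : (2 : ℝ) ^ (s - padicValNat 2 m) * (2 : ℝ) ^ (τ * m) * (2 : ℝ) ^ e = (2 : ℝ) ^ (n + τ + s) := by
    rw [← pow_add, ← pow_add]
    congr 1
    omega
  linear_combination (c : ℝ) * (-1) ^ (i.val) * (u : ℝ) * (nt : ℝ) ^ m * epow

/-! ### Korobov's bound for the Postnikov sums -/

/-- ★ **Korobov's bound for the Postnikov sums of a primitive character mod `2^{n+τ}`** (`n ≥ 1`, `τ ≥ 2`, odd `ñ`):
with Korobov parameters `Y ≥ 10`, `L ≥ 10⁶Y²`, `4.91Y ≤ r ≤ 5.01Y`, `r ≥ 50`, `k = 5r²`, `1 ≤ a ≤ e^{0.4L}`, `r ≤ n+τ`,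
the truncation condition `n + τ + v₂(m) ≤ τm` for `r < m ≤ n+τ`, and good indices `m ∈ (M₂, M₃]`
(`M₃ ≤ r`, `M₃ − M₂ ∈ [1.5Y−1, 1.5Y+1]`) with `τm < n+τ+v₂(m)`, `2^{e_m} ≤ k a^m` and `(4 + log 2^{e_m})/2^{e_m} ≤ θ*(L,Y)`
(`e_m = n+τ+v₂(m)−τm`): `‖Σ_{x,y≤a} χ(1 + 2^τ ñ xy)‖ ≤ a² e^{10} exp(−2·10⁻⁶L/Y²)`.
(Postnikov's formula + truncation + `…KorobovFactors` + `norm_Usum_le_of_good` with `J_le_four`, `B = 4`.)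
[cite: Ivic1985, Theorem 6.2] [cite: IwaniecKowalski2004, §12.3 (Postnikov–Gallagher)] -/
theorem norm_postnikovSum_le {τ : ℕ} (hτ : 2 ≤ τ) {n : ℕ} (hn : 1 ≤ n)
    (χ : DirichletCharacter ℂ (2 ^ (n + τ))) (hχ : χ.IsPrimitive)
    {L Y : ℝ} {r k a M₂ M₃ : ℕ} (hY : 10 ≤ Y) (hL : (10 : ℝ) ^ 6 * Y ^ 2 ≤ L)
    (hr1 : 4.91 * Y ≤ r) (hr2 : (r : ℝ) ≤ 5.01 * Y) (hr50 : 50 ≤ r) (hk : k = 5 * r ^ 2)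
    (ha1 : 1 ≤ a) (hahi : (a : ℝ) ≤ Real.exp (0.4 * L)) (hrn : r ≤ n + τ) (hM : M₃ ≤ r)
    (hG1 : 1.5 * Y - 1 ≤ ((M₃ - M₂ : ℕ) : ℝ)) (hG2 : ((M₃ - M₂ : ℕ) : ℝ) ≤ 1.5 * Y + 1)
    (htrunc : ∀ m : ℕ, r < m → m ≤ n + τ → n + τ + padicValNat 2 m ≤ τ * m)
    (hgood : ∀ m : ℕ, M₂ < m → m ≤ M₃ → τ * m < n + τ + padicValNat 2 m ∧
      (2 : ℝ) ^ (n + τ + padicValNat 2 m - τ * m) ≤ (k : ℝ) * (a : ℝ) ^ m ∧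
      (4 + Real.log (2 ^ (n + τ + padicValNat 2 m - τ * m))) / 2 ^ (n + τ + padicValNat 2 m - τ * m) ≤
        thetaStar L Y)
    {nt : ℕ} (hnt : Odd nt) :
    ‖∑ x ∈ Finset.Icc 1 a, ∑ y ∈ Finset.Icc 1 a,
        χ (1 + (2 : ZMod (2 ^ (n + τ))) ^ τ * ((nt : ZMod (2 ^ (n + τ))) * ((x * y : ℕ) : ZMod (2 ^ (n + τ)))))‖ ≤
      (a : ℝ) ^ 2 * Real.exp 10 * Real.exp (-(2e-6 * L / Y ^ 2)) := by
  obtain ⟨c, hc, hcsum⟩ := postnikovSum_eq_Usum hτ hn χ hχ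
  rw [hcsum nt a]
  -- the Postnikov phase of degree `n + τ` and its truncation to degree `r`
  set αf : Fin (n + τ) → ℝ := fun i : Fin (n + τ) =>
    (c : ℝ) * (-1) ^ (i.val) * (((n + τ).factorial / (i.val + 1) : ℕ) : ℝ) * (2 : ℝ) ^ (τ * (i.val + 1)) *
      (nt : ℝ) ^ (i.val + 1) / (2 : ℝ) ^ (n + τ + padicValNat 2 (n + τ).factorial) with hαf
  have htr : Usum a αf = Usum a (fun i : Fin r => αf (Fin.castLE hrn i)) := by
    refine Usum_eq_Usum_truncate hrn a αf fun i hi => ?_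
    exact postnikovCoeff_int c nt i (htrunc (i.val + 1) (by omega) (by omega))
  change ‖Usum a αf‖ ≤ _
  rw [htr]
  set α : Fin r → ℝ := fun i : Fin r => αf (Fin.castLE hrn i) with hα
  -- the good factors
  have hk1 : 1 ≤ k := by rw [hk]; nlinarith
  have hgood' : ∀ j : Fin r, j.val ∈ Ico M₂ M₃ → mnSum k a α j ≤ (2 * (Abnd k a j : ℝ)) ^ 2 * thetaStar L Y := by
    intro j hj
    rw [mem_Ico] at hj
    obtain ⟨hsm, h2e, hθ⟩ := hgood (j.val + 1) (by omega) (by omega)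
    obtain ⟨b, hb, hform⟩ := postnikovCoeff_twoPower hc hnt (Fin.castLE hrn j) (by simpa using hsm)
    have hαj : α j = (b : ℝ) / 2 ^ (n + τ + padicValNat 2 (j.val + 1) - τ * (j.val + 1)) + ((0 : ℤ) : ℝ) := by
      rw [hα]; dsimp only; rw [hαf]; dsimp only
      simpa using hform
    have hA : (2 : ℝ) ^ (n + τ + padicValNat 2 (j.val + 1) - τ * (j.val + 1)) ≤ (Abnd k a j : ℝ) := by
      unfold Abnd; push_cast; exact h2e
    refine (mnSum_le_sq_mul_of_twoPower k a α j hb hαj hA).trans ?_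
    exact mul_le_mul_of_nonneg_left hθ (sq_nonneg _)
  -- the mean value bound and the generic Korobov step (`B = 4`, `e^{4²/2+2} = e^{10}`)
  have hJ := J_le_four hr50 ha1 hk
  have h := norm_Usum_le_of_good (B := 4) (by norm_num) α hY hL hr1 hr2 hr50 hk ha1 hahi hM hgood' hG1 hG2 hJ
  have e10 : (4 : ℝ) ^ 2 / 2 + 2 = 10 := by norm_num
  rw [e10] at h
  exact h

end Summit.ValiantsHypothesis.ValiantsHypothesis.Theorems.LiouvilleSarnak.AlignedTypeI.CharactersModTwoN
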